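import Mathlib
import HarnessLib

/-!
# Rivoal's very-well-poised series — definitions

Topic `Literature/NumberTheory/Transcendental`. Definitions file (everything else is proved).

Rivoal (C. R. Acad. Sci. 331 (2000), §1–2) proves that infinitely many `ζ(2n+1)` are irrational
(and the dimension bound `ball_rivoal` of `PeriodsWave0.lean`) with the series
`S_n = ∑_{k ≥ 1} R_n(k)`, where for integers `a ≥ 3`, `1 ≤ r < a/2`, `n ≥ 0`
`R_n(t) = n!^{a-2r} (t-rn)_{rn} (t+n+1)_{rn} / (t)_{n+1}^a`, `(x)_m = x(x+1)⋯(x+m-1)`.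
(We shift Rivoal's variable by one, `t ↦ t - 1`, so that the poles are `0, -1, …, -n` as in the
tree's partial-fraction tool-kit `OddZetaPartialFractions.lean`; Rivoal sums over `k ≥ 0`,
we over `k ≥ 1`.) This file only fixes the objects:

* `ratfun a r n t` — `R_n(t)` as a real function of a real variable;
* `series a r n = ∑' k, R_n(k+1)` — `S_n`;
* `Phi a r x = (a+1)(x log x − (x+1) log (x+1)) + (x+r+1) log(x+r+1) − (x−r) log(x−r)` — the
  exponent governing `R_n(k)` for `k ≈ x n` (Stirling), `lim S_n^{1/n} = exp (sup_{x ≥ r} Φ)`;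

and the first lemmas: the terms with `1 ≤ k ≤ rn` vanish, the others are positive, and the
factorial form of `R_n(m+1)` for `m ≥ rn`.

## References

* T. Rivoal, *La fonction zêta de Riemann prend une infinité de valeurs irrationnelles aux
  entiers impairs*, C. R. Acad. Sci. Paris 331 (2000) 267–270, §1 (`S_n(z)`, `R_n`). [Rivoal2000]
* K. Ball, T. Rivoal, Invent. Math. 146 (2001) 193–207. [BallRivoal2001]
-/

noncomputable section

open Finset Real
open scoped Nat

namespace Literature.NumberTheory.Transcendental

namespace RivoalSeries

/-- Rivoal's rational function `R_n(t) = n!^{a-2r} (t-rn)_{rn} (t+n+1)_{rn} / (t)_{n+1}^a`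
(shifted so that its poles are `0, -1, …, -n`), as a real function.
[cite: Rivoal2000, §1 (definition of S_n(z) and R_n)] -/
def ratfun (a r n : ℕ) (t : ℝ) : ℝ :=
  (n ! : ℝ) ^ (a - 2 * r) * (∏ q ∈ range (r * n), (t - r * n + q)) *
    (∏ q ∈ range (r * n), (t + n + 1 + q)) / (∏ q ∈ range (n + 1), (t + q)) ^ a

/-- Rivoal's series `S_n = S_n(1) = ∑_{k ≥ 1} R_n(k)`. [cite: Rivoal2000, §1] -/
def series (a r n : ℕ) : ℝ := ∑' k : ℕ, ratfun a r n (k + 1)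

/-- The Stirling exponent `Φ_{a,r}(x) = (a+1)(x log x − (x+1) log(x+1)) + (x+r+1) log(x+r+1)
− (x−r) log(x−r)`: `log R_n(k) = n Φ(k/n) + O(log(k+n))` uniformly, so that
`lim S_n^{1/n} = exp(sup_{x ≥ r} Φ)` (our elementary form of Rivoal's Lemme 3). [folklore] -/
def Phi (a r : ℕ) (x : ℝ) : ℝ :=
  (a + 1) * (x * log x - (x + 1) * log (x + 1)) +
    ((x + r + 1) * log (x + r + 1) - (x - r) * log (x - r))

/-! ### First properties of the summand -/

/-- The terms `R_n(k)`, `1 ≤ k ≤ rn`, vanish (the Pochhammer factor `(k-rn)_{rn}` does).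
[cite: Rivoal2000, §1] -/
theorem ratfun_nat_eq_zero (a r n : ℕ) {k : ℕ} (hk1 : 1 ≤ k) (hk : k ≤ r * n) :
    ratfun a r n k = 0 := by
  unfold ratfun
  have : ∏ q ∈ range (r * n), ((k : ℝ) - r * n + q) = 0 := by
    refine prod_eq_zero (i := r * n - k) (mem_range.2 (by omega)) ?_
    rw [Nat.cast_sub hk]; push_cast; ring
  rw [this]; simp

/-- For `m ≥ rn` every factor of `R_n(m+1)` is positive; factorial form of the three Pochhammer
products: `(m+1-rn)_{rn} = m!/(m-rn)!`, `(m+n+2)_{rn} = (m+n+1+rn)!/(m+n+1)!`,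
`(m+1)_{n+1} = (m+n+1)!/m!`. [folklore] -/
theorem prod_shift_eq (r n m : ℕ) (hm : r * n ≤ m) :
    (∏ q ∈ range (r * n), ((m + 1 : ℕ) - (r * n : ℝ) + q)) = (m ! : ℝ) / (m - r * n)! ∧
    (∏ q ∈ range (r * n), ((m + 1 : ℕ) + (n : ℝ) + 1 + q)) = ((m + n + 1 + r * n)! : ℝ) / (m + n + 1)! ∧
    (∏ q ∈ range (n + 1), ((m + 1 : ℕ) + (q : ℝ))) = ((m + n + 1)! : ℝ) / m ! := by
  refine ⟨?_, ?_, ?_⟩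
  · rw [eq_div_iff (by positivity)]
    have h := Nat.factorial_mul_ascFactorial (m - r * n) (r * n)
    rw [Nat.sub_add_cancel hm, Nat.ascFactorial_eq_prod_range] at h
    have h' := congrArg (fun x : ℕ => (x : ℝ)) h
    push_cast at h'
    rw [← h', mul_comm]
    congr 1
    refine prod_congr rfl fun q _ => ?_
    rw [Nat.cast_sub hm]; push_cast; ring
  · rw [eq_div_iff (by positivity)]
    have h := Nat.factorial_mul_ascFactorial (m + n + 1) (r * n)
    rw [Nat.ascFactorial_eq_prod_range] at h
    have h' := congrArg (fun x : ℕ => (x : ℝ)) h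
    push_cast at h'
    rw [← h', mul_comm]
    congr 1
    refine prod_congr rfl fun q _ => ?_
    push_cast; ring
  · rw [eq_div_iff (by positivity)]
    have h := Nat.factorial_mul_ascFactorial m (n + 1)
    rw [Nat.ascFactorial_eq_prod_range, show m + (n + 1) = m + n + 1 by ring] at h
    have h' := congrArg (fun x : ℕ => (x : ℝ)) h
    push_cast at h'
    rw [← h', mul_comm]
    congr 1
    refine prod_congr rfl fun q _ => ?_
    push_cast; ring

/-- **Factorial form.** For `m ≥ rn`,
`R_n(m+1) = n!^{a-2r} · m!/(m-rn)! · (m+n+1+rn)!/(m+n+1)! · (m!/(m+n+1)!)^a`. [folklore] -/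
theorem ratfun_succ_eq (a r n m : ℕ) (hm : r * n ≤ m) :
    ratfun a r n ((m + 1 : ℕ) : ℝ) =
      (n ! : ℝ) ^ (a - 2 * r) * ((m ! : ℝ) / (m - r * n)!) *
        (((m + n + 1 + r * n)! : ℝ) / (m + n + 1)!) * ((m ! : ℝ) / (m + n + 1)!) ^ a := by
  obtain ⟨h1, h2, h3⟩ := prod_shift_eq r n m hm
  unfold ratfun
  rw [h1, h2, h3, div_pow, div_pow]
  field_simp

/-- For `m ≥ rn` the term `R_n(m+1)` is positive. [cite: Rivoal2000, §1] -/
theorem ratfun_succ_pos (a r n m : ℕ) (hm : r * n ≤ m) : 0 < ratfun a r n ((m + 1 : ℕ) : ℝ) := by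
  rw [ratfun_succ_eq a r n m hm]
  positivity

/-- All terms `R_n(k+1)`, `k ≥ 0`, are non-negative. [cite: Rivoal2000, §1] -/
theorem ratfun_succ_nonneg (a r n k : ℕ) : 0 ≤ ratfun a r n ((k + 1 : ℕ) : ℝ) := by
  rcases lt_or_ge k (r * n) with h | h
  · rw [ratfun_nat_eq_zero a r n (k := k + 1) (by omega) (by omega)]
  · exact (ratfun_succ_pos a r n k h).le

end RivoalSeries

end Literature.NumberTheory.Transcendental
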